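import Literature.Probability.RandomPlanarGeometry.HexSAWStripWidthTwoHatContactAnnihilator
import HarnessLib

/-!
# The width-two strip: the fourth contact annihilator — `Σ t_rĈ⁴ + 4Σ ṫ_rĈ³ + 6Σ ṫ_rĈ² + 4Σ ṫ_rĈ + Σ ṫ_rD̂ = 0`
# (module «WIDTH-TWO HAT FOURTH CONTACT ANNIHILATOR»)

Topic `Literature/Probability/RandomPlanarGeometry` (continues «WIDTH-TWO HAT CONTACT ANNIHILATOR» — `W2.detYTwo`, `W2.detYTwoDot` (linear in `y`, so every higher
`y∂_y` of `t_r` is `ṫ_r`), `W2.hatC3DTwo`, `W2.detYTwo_contact_cube_annihilator`, the derivative plumbing).  Lane «pcv-sawmu» (CriticalPhenomena venture), a-p2 g29 —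
input of the FOURTH contact cumulant of `S₂`.  One more `y∂_y` (weights `1, 4, 6, 4, 1`).  Frame: W. Feller I (1968) XIII.6; nothing below is printed.

## What is proved (namespace `…SAW.HV.W2`)
`hatC4DTwo` (`Σ #top⁴·wD`), `hasDerivAt_contactCubeSum_two`, `mul_derivContactCubeSum_two_eq` (`y∂_yĈ³ = Ĉ⁴`), ★★★ `detYTwo_contact_fourth_annihilator`.

Label: LANE THEOREM (own result of lane «pcv-sawmu», a-p2 g29, 2026-08-28; not in print).
-/

noncomputable section

open Finset Filter Topology Matrix Literature.Probability.LatticeModels Literature.Probability.Percolation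

namespace Literature.Probability.RandomPlanarGeometry.SAW

namespace HV

namespace W2

/-- The fourth-power-weighted contact hat bridge sum of `S₂`: `Ĉ⁴(k)_{ab} = Σ #top⁴·x^{#steps}y^{#top}`. [cite: Feller1968, XIII.6; DuminilCopinHammond2013, §2.2; lane «pcv-sawmu» a-p2 g29] -/
def hatC4DTwo (y : ℝ) (k : ℕ) : Matrix (Fin (2 * 2)) (Fin (2 * 2)) ℝ :=
  Matrix.of fun a b : Fin (2 * 2) => ∑ l ∈ LUset 2 (2 * k + 1) (hatLen k a b) (a : ℕ) (b : ℕ), (topCnt 2 l.tail : ℝ) ^ 4 * wD 2 y l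

/-- `k·y^{k−1}·y = k·y^k` (plumbing, private). [folklore] -/
private theorem natMul_pow_pred_mul_w2' (k : ℕ) (y : ℝ) : (k : ℝ) * y ^ (k - 1) * y = (k : ℝ) * y ^ k := by
  rcases Nat.eq_zero_or_pos k with h | h
  · subst h; simp
  · rw [mul_assoc, ← pow_succ, Nat.sub_add_cancel h]

/-- The cube-weighted contact sum over a finite set of words is differentiable in `y` (plumbing). [cite: DuminilCopinHammond2013, §2.2; lane plumbing] -/
theorem hasDerivAt_contactCubeSum_two (S : Finset (List HV)) (y : ℝ) :
    HasDerivAt (fun y => ∑ l ∈ S, (topCnt 2 l.tail : ℝ) ^ 3 * wD 2 y l)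
      (∑ l ∈ S, (topCnt 2 l.tail : ℝ) ^ 3 * (hexCriticalFugacity ^ (l.length - 1) * ((topCnt 2 l.tail : ℝ) * y ^ (topCnt 2 l.tail - 1)))) y := by
  unfold wD
  exact HasDerivAt.fun_sum fun l _ => ((hasDerivAt_pow _ y).const_mul _).const_mul _

/-- `y · ∂_y Σ #top³·wD = Σ #top⁴·wD` (plumbing). [cite: DuminilCopinHammond2013, §2.2; lane plumbing] -/
theorem mul_derivContactCubeSum_two_eq (S : Finset (List HV)) (y : ℝ) :
    y * ∑ l ∈ S, (topCnt 2 l.tail : ℝ) ^ 3 * (hexCriticalFugacity ^ (l.length - 1) * ((topCnt 2 l.tail : ℝ) * y ^ (topCnt 2 l.tail - 1))) =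
      ∑ l ∈ S, (topCnt 2 l.tail : ℝ) ^ 4 * wD 2 y l := by
  rw [mul_sum]
  refine sum_congr rfl fun l _ => ?_
  unfold wD
  calc y * ((topCnt 2 l.tail : ℝ) ^ 3 * (hexCriticalFugacity ^ (l.length - 1) * ((topCnt 2 l.tail : ℝ) * y ^ (topCnt 2 l.tail - 1))))
      = (topCnt 2 l.tail : ℝ) ^ 3 * hexCriticalFugacity ^ (l.length - 1) * ((topCnt 2 l.tail : ℝ) * y ^ (topCnt 2 l.tail - 1) * y) := by ring
    _ = _ := by rw [natMul_pow_pred_mul_w2']; ring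

/-- ★★★ **Fourth contact annihilator of `S₂`**: for `y > 0`, all levels and all `n`,
`Σ_{r<5} t_rĈ⁴(n+1+r) + 4Σ ṫ_rĈ³(n+1+r) + 6Σ ṫ_rĈ²(n+1+r) + 4Σ ṫ_rĈ(n+1+r) + Σ ṫ_rD̂(n+1+r) = 0` (`y∂_y` of the cube annihilator; `ẗ = ṫ`).
[cite: Feller1968, XIII.6; Stanley2012EC1, §4.1 Theorem 4.1.1 (iii); lane «pcv-sawmu» a-p2 g29 — own result] -/
theorem detYTwo_contact_fourth_annihilator {y : ℝ} (hy : 0 < y) (a b : Fin (2 * 2)) (n : ℕ) :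
    ∑ r ∈ range 5, detYTwo y r * hatC4DTwo y (n + 1 + r) a b + 4 * ∑ r ∈ range 5, detYTwoDot y r * hatC3DTwo y (n + 1 + r) a b
      + 6 * ∑ r ∈ range 5, detYTwoDot y r * hatC2D y (n + 1 + r) a b + 4 * ∑ r ∈ range 5, detYTwoDot y r * hatCD y (n + 1 + r) a b
      + ∑ r ∈ range 5, detYTwoDot y r * hatD 2 y (n + 1 + r) a b = 0 := by
  set dU : ℕ → ℝ → ℝ := fun k y =>
    ∑ l ∈ LUset 2 (2 * k + 1) (hatLen k a b) (a : ℕ) (b : ℕ), hexCriticalFugacity ^ (l.length - 1) * ((topCnt 2 l.tail : ℝ) * y ^ (topCnt 2 l.tail - 1))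
    with hdU
  set dC : ℕ → ℝ → ℝ := fun k y =>
    ∑ l ∈ LUset 2 (2 * k + 1) (hatLen k a b) (a : ℕ) (b : ℕ),
      (topCnt 2 l.tail : ℝ) * (hexCriticalFugacity ^ (l.length - 1) * ((topCnt 2 l.tail : ℝ) * y ^ (topCnt 2 l.tail - 1))) with hdC
  set dC2 : ℕ → ℝ → ℝ := fun k y =>
    ∑ l ∈ LUset 2 (2 * k + 1) (hatLen k a b) (a : ℕ) (b : ℕ),
      (topCnt 2 l.tail : ℝ) ^ 2 * (hexCriticalFugacity ^ (l.length - 1) * ((topCnt 2 l.tail : ℝ) * y ^ (topCnt 2 l.tail - 1))) with hdC2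
  set dC3 : ℕ → ℝ → ℝ := fun k y =>
    ∑ l ∈ LUset 2 (2 * k + 1) (hatLen k a b) (a : ℕ) (b : ℕ),
      (topCnt 2 l.tail : ℝ) ^ 3 * (hexCriticalFugacity ^ (l.length - 1) * ((topCnt 2 l.tail : ℝ) * y ^ (topCnt 2 l.tail - 1))) with hdC3
  have hD : ∀ k (y : ℝ), HasDerivAt (fun y => hatD 2 y k a b) (dU k y) y := fun k y => hasDerivAt_LUs (2 * k + 1) (hatLen k a b) _ _ y
  have hC : ∀ k (y : ℝ), HasDerivAt (fun y => hatCD y k a b) (dC k y) y := fun k y => by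
    simp only [hatCD, Matrix.of_apply]; exact hasDerivAt_contactSum _ y
  have hC2d : ∀ k (y : ℝ), HasDerivAt (fun y => hatC2D y k a b) (dC2 k y) y := fun k y => by
    simp only [hatC2D, Matrix.of_apply]; exact hasDerivAt_contactSqSum_two _ y
  have hC3d : ∀ k (y : ℝ), HasDerivAt (fun y => hatC3DTwo y k a b) (dC3 k y) y := fun k y => by
    simp only [hatC3DTwo, Matrix.of_apply]; exact hasDerivAt_contactCubeSum_two _ y
  have hU : ∀ k, y * dU k y = hatCD y k a b := fun k => by
    rw [hdU]; simp only [hatCD, Matrix.of_apply]; exact mul_derivSum_eq_contactSum _ y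
  have hC2 : ∀ k, y * dC k y = hatC2D y k a b := fun k => by
    rw [hdC]; simp only [hatC2D, Matrix.of_apply]; exact mul_derivContactSum_eq _ y
  have hC3 : ∀ k, y * dC2 k y = hatC3DTwo y k a b := fun k => by
    rw [hdC2]; simp only [hatC3DTwo, Matrix.of_apply]; exact mul_derivContactSqSum_two_eq _ y
  have hC4 : ∀ k, y * dC3 k y = hatC4DTwo y k a b := fun k => by
    rw [hdC3]; simp only [hatC4DTwo, Matrix.of_apply]; exact mul_derivContactCubeSum_two_eq _ y
  choose dT hdT hTdot using fun r => hasDerivAt_detYTwo y r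
  choose dTd hdTd hTddot using fun r => hasDerivAt_detYTwoDot y r
  have hdd : ∀ r, dTd r = dT r := fun r => mul_left_cancel₀ hy.ne' ((hTddot r).trans (hTdot r).symm)
  set F : ℝ → ℝ := fun y => ∑ r ∈ range 5, detYTwo y r * hatC3DTwo y (n + 1 + r) a b + 3 * ∑ r ∈ range 5, detYTwoDot y r * hatC2D y (n + 1 + r) a b
      + 3 * ∑ r ∈ range 5, detYTwoDot y r * hatCD y (n + 1 + r) a b + ∑ r ∈ range 5, detYTwoDot y r * hatD 2 y (n + 1 + r) a b with hF
  have hFd : HasDerivAt F (∑ r ∈ range 5, (dT r * hatC3DTwo y (n + 1 + r) a b + detYTwo y r * dC3 (n + 1 + r) y)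
      + 3 * ∑ r ∈ range 5, (dTd r * hatC2D y (n + 1 + r) a b + detYTwoDot y r * dC2 (n + 1 + r) y)
      + 3 * ∑ r ∈ range 5, (dTd r * hatCD y (n + 1 + r) a b + detYTwoDot y r * dC (n + 1 + r) y)
      + ∑ r ∈ range 5, (dTd r * hatD 2 y (n + 1 + r) a b + detYTwoDot y r * dU (n + 1 + r) y)) y := by
    rw [hF]
    exact (((HasDerivAt.fun_sum fun r _ => (hdT r).mul (hC3d (n + 1 + r) y)).add
      ((HasDerivAt.fun_sum fun r _ => (hdTd r).mul (hC2d (n + 1 + r) y)).const_mul 3)).add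
      ((HasDerivAt.fun_sum fun r _ => (hdTd r).mul (hC (n + 1 + r) y)).const_mul 3)).add
      (HasDerivAt.fun_sum fun r _ => (hdTd r).mul (hD (n + 1 + r) y))
  have hF0 : F =ᶠ[𝓝 y] fun _ => (0 : ℝ) := by
    filter_upwards [Ioi_mem_nhds hy] with y' hy'
    rw [hF]; exact detYTwo_contact_cube_annihilator hy' a b n
  have hzero := (hFd.congr_of_eventuallyEq hF0.symm).unique (hasDerivAt_const y (0 : ℝ))
  have hmul : y * (∑ r ∈ range 5, (dT r * hatC3DTwo y (n + 1 + r) a b + detYTwo y r * dC3 (n + 1 + r) y)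
      + 3 * ∑ r ∈ range 5, (dTd r * hatC2D y (n + 1 + r) a b + detYTwoDot y r * dC2 (n + 1 + r) y)
      + 3 * ∑ r ∈ range 5, (dTd r * hatCD y (n + 1 + r) a b + detYTwoDot y r * dC (n + 1 + r) y)
      + ∑ r ∈ range 5, (dTd r * hatD 2 y (n + 1 + r) a b + detYTwoDot y r * dU (n + 1 + r) y))
      = ∑ r ∈ range 5, detYTwo y r * hatC4DTwo y (n + 1 + r) a b + 4 * ∑ r ∈ range 5, detYTwoDot y r * hatC3DTwo y (n + 1 + r) a b
        + 6 * ∑ r ∈ range 5, detYTwoDot y r * hatC2D y (n + 1 + r) a b + 4 * ∑ r ∈ range 5, detYTwoDot y r * hatCD y (n + 1 + r) a b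
        + ∑ r ∈ range 5, detYTwoDot y r * hatD 2 y (n + 1 + r) a b := by
    simp only [mul_add, Finset.mul_sum, ← Finset.sum_add_distrib]
    refine Finset.sum_congr rfl fun r _ => ?_
    rw [hdd r, ← hU (n + 1 + r), ← hC2 (n + 1 + r), ← hC3 (n + 1 + r), ← hC4 (n + 1 + r), ← hTdot r]; ring
  rw [← hmul, hzero, mul_zero]

end W2

end HV

end Literature.Probability.RandomPlanarGeometry.SAW
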